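import Literature.NumberTheory.EllipticCurves.GaussianLatticeFifthDivision
import HarnessLib

/-!
# The Gaussian lattice `ℤi + ℤ`: the diagonal fifth-division values, the half-period shift
# `℘(z + ω₃)` and its derivative, and `℘(u) ≠ ±℘(v)` for a quarter point and a fifth point

Topic `Literature/NumberTheory/EllipticCurves` (complex-lattice cluster), continuing
`GaussianLatticeFifthDivision` (real fifth-division values `p₁ = ℘(1/5)`, `p₂ = ℘(2/5)` through
their symmetric functions `p₁² + p₂² = (6 + 4√5)e²`, `p₁²p₂² = (9 + 4√5)e⁴`, `e = ϖ₀²`,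
`ϖ₀ = Γ(1/4)²/(2√(2π))`, and complex multiplication by `1 + i`). Filed for the named fact
`Literature.NumberTheory.EllipticCurves.BirchSwinnertonDyer1965_L_one_two_ten` (second conjunct
`L(E₁₀, 1) = 2β/√10`, fixing `γ₅` in Tunnell's Theorem 3, Invent. Math. 72, p. 329): in the
evaluation of `L(E₁₀, 1)` as a twisted sum of Eisenstein–Kronecker numbers over `ℤ[i]/20`
(`CongruentNumberCurveLValueKronecker`), the sixteen unit classes modulo `5` fall into the four
unit orbits of `1/5, 2/5, (1+i)/5, (2+2i)/5`, and only the **squares** of the four values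
`pₖ = ℘(·)` enter, through their elementary symmetric functions. Everything here is **proved**
(no definitions, no named facts), and no individual division value is identified (no branch of
an algebraic number has to be located analytically):

* `weierstrassP_one_add_I_fifth`, `weierstrassP_two_add_two_I_fifth`, `weierstrassP_diag_fifth_sq`
  — `p₃ = ℘((1+i)/5) = −(i/2)(p₁² − e²)/p₁`, `p₄ = ℘((2+2i)/5) = −(i/2)(p₂² − e²)/p₂`
  (`weierstrassP_one_add_I_mul` of `GaussianLatticeFifthDivision`), `p₃² = −(p₁² − e²)²/(4p₁²)`;
* `fifth_diag_sum_sq_and_prod_sq` — **`p₃² + p₄² = (6 − 4√5)e²`, `p₃²p₄² = (9 − 4√5)e⁴`**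
  (from `fifth_division_vieta`, via `(p₁² − e²)(p₂² − e²) = 4e⁴`): the `ℚ(√5)`-conjugate factor
  `t² − (6 − 4√5)t + (9 − 4√5)` of the `5`-division polynomial of `y² = x³ − x` in `t = x²`;
* `weierstrassP_fifth_sum_sq_and_prod_sq` — the real Vieta relations in complex form;
* `weierstrassP_add_omega₃`, `derivWeierstrassP_add_omega₃` — `℘(z + ω₃) = −(g₂/4)/℘(z)` and
  **`℘'(z + ω₃) = (g₂/4)℘'(z)/℘(z)²`** (`ω₃ = (1+i)/2`, for `z ∉ Λ`, `℘(z) ≠ 0`; the derivative by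
  differentiating the identity on a neighbourhood of `z`);
* `weierstrassP_quarter_ne_fifth` — `℘(u) ≠ ±℘(v)` whenever `4u, 5v ∈ Λ`, `u, v ∉ Λ`
  (`℘(u) = ℘(w)` forces `u ≡ ±w`, then `u = 5u − 4u ∈ Λ`; and `−℘(v) = ℘(iv)`).

Numerically `p₃/e = −1.71033 i`, `p₄/e = 0.13802 i` (checked against lattice sums).

## References

* B. J. Birch, H. P. F. Swinnerton-Dyer, *Notes on elliptic curves. II*, J. reine angew. Math. 218
  (1965) 79–108, §3 (3.12), (3.15) (Case 2, `Δ = 5`) and Table 1 (`L(Γ₁₀₀, 1) = 2β/√10`).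
* E. T. Whittaker, G. N. Watson, *A Course of Modern Analysis*, 4th ed., §20.3–20.33.
-/

noncomputable section

open Complex PeriodPair Real Set Filter Topology
open scoped Real Topology PeriodPair

namespace Literature.NumberTheory.EllipticCurves

namespace GaussianLattice

/-! ### Lattice membership of fifth-division points -/

/-- `1/5 ∉ ℤi + ℤ`. [folklore] -/
theorem one_fifth_notMem : (1 / 5 : ℂ) ∉ (ofUpperHalfPlane UpperHalfPlane.I).lattice := by
  refine notMem_lattice_of_re fun n h ↦ ?_
  norm_num at h
  have h5 : (5 * n : ℝ) = 1 := by linarith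
  have : (5 * n : ℤ) = 1 := by exact_mod_cast h5
  omega

/-- `2/5 ∉ ℤi + ℤ`. [folklore] -/
theorem two_fifths_notMem : (2 / 5 : ℂ) ∉ (ofUpperHalfPlane UpperHalfPlane.I).lattice := by
  refine notMem_lattice_of_re fun n h ↦ ?_
  norm_num at h
  have h5 : (5 * n : ℝ) = 2 := by linarith
  have : (5 * n : ℤ) = 2 := by exact_mod_cast h5
  omega

/-- `(1+i)/5 ∉ ℤi + ℤ`. [folklore] -/
theorem one_add_I_fifth_notMem : ((1 + I) / 5 : ℂ) ∉ (ofUpperHalfPlane UpperHalfPlane.I).lattice := by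
  refine notMem_lattice_of_re fun n h ↦ ?_
  norm_num at h
  have h5 : (5 * n : ℝ) = 1 := by linarith
  have : (5 * n : ℤ) = 1 := by exact_mod_cast h5
  omega

/-- `(2+2i)/5 ∉ ℤi + ℤ`. [folklore] -/
theorem two_add_two_I_fifth_notMem :
    ((2 + 2 * I) / 5 : ℂ) ∉ (ofUpperHalfPlane UpperHalfPlane.I).lattice := by
  refine notMem_lattice_of_re fun n h ↦ ?_
  norm_num at h
  have h5 : (5 * n : ℝ) = 2 := by linarith
  have : (5 * n : ℤ) = 2 := by exact_mod_cast h5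
  omega

/-- A real number in `(0, 1)` is not a lattice point (cast form). [folklore] -/
theorem ofReal_notMem {t : ℝ} (h0 : 0 < t) (h1 : t < 1) :
    (t : ℂ) ∉ (ofUpperHalfPlane UpperHalfPlane.I).lattice :=
  isReal.ofReal_notMem_lattice h0 (by rw [minRealPeriod_eq]; exact h1)

/-! ### Positivity of the real fifth-division values (from `weierstrassPRe_fifths_order`) -/

/-- `0 < p₂` and `0 < p₁` (`ϖ₀² < ℘(2/5) < ℘(1/4) < ℘(1/5)`,
`GaussianLatticeFifthDivision.weierstrassPRe_fifths_order`). [folklore] -/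
theorem fifth_pos :
    0 < (ofUpperHalfPlane UpperHalfPlane.I).weierstrassPRe (2 / 5) ∧
      0 < (ofUpperHalfPlane UpperHalfPlane.I).weierstrassPRe (1 / 5) := by
  obtain ⟨h2, h24, h41⟩ := weierstrassPRe_fifths_order
  have := pow_pos varpi_pos 2
  exact ⟨by linarith, by linarith⟩

/-! ### Complex forms of the fifth-division values -/

/-- `℘(1/5) = p₁`. [folklore] -/
theorem weierstrassP_one_fifth :
    ℘[ofUpperHalfPlane UpperHalfPlane.I] (1 / 5) =
      (((ofUpperHalfPlane UpperHalfPlane.I).weierstrassPRe (1 / 5) : ℝ) : ℂ) := by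
  rw [isReal.ofReal_weierstrassPRe]; push_cast; ring_nf

/-- `℘(2/5) = p₂`. [folklore] -/
theorem weierstrassP_two_fifths :
    ℘[ofUpperHalfPlane UpperHalfPlane.I] (2 / 5) =
      (((ofUpperHalfPlane UpperHalfPlane.I).weierstrassPRe (2 / 5) : ℝ) : ℂ) := by
  rw [isReal.ofReal_weierstrassPRe]; push_cast; ring_nf

/-- `℘(1/5) ≠ 0`, `℘(2/5) ≠ 0`. [folklore] -/
theorem weierstrassP_fifth_ne_zero :
    ℘[ofUpperHalfPlane UpperHalfPlane.I] (1 / 5) ≠ 0 ∧ ℘[ofUpperHalfPlane UpperHalfPlane.I] (2 / 5) ≠ 0 := by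
  obtain ⟨h2, h1⟩ := fifth_pos
  rw [weierstrassP_one_fifth, weierstrassP_two_fifths, Complex.ofReal_ne_zero, Complex.ofReal_ne_zero]
  exact ⟨h1.ne', h2.ne'⟩

/-! ### The diagonal fifth-division values via complex multiplication by `1 + i` -/

/-- `p₃ = ℘((1+i)/5) = −(i/2)(p₁² − e²)/p₁` (`e² = ϖ₀⁴`). [folklore] -/
theorem weierstrassP_one_add_I_fifth :
    ℘[ofUpperHalfPlane UpperHalfPlane.I] ((1 + I) / 5) =
      -(I / 2) * ((((ofUpperHalfPlane UpperHalfPlane.I).weierstrassPRe (1 / 5) : ℝ) : ℂ) ^ 2 -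
          ((Real.Gamma (1 / 4) ^ 2 / (2 * Real.sqrt (2 * π)) : ℝ) : ℂ) ^ 4) /
        (((ofUpperHalfPlane UpperHalfPlane.I).weierstrassPRe (1 / 5) : ℝ) : ℂ) := by
  have h := weierstrassP_one_add_I_mul one_fifth_notMem weierstrassP_fifth_ne_zero.1
  rw [show (1 + I) * (1 / 5 : ℂ) = (1 + I) / 5 by ring, weierstrassP_one_fifth] at h
  rw [h]
  have hp : (((ofUpperHalfPlane UpperHalfPlane.I).weierstrassPRe (1 / 5) : ℝ) : ℂ) ≠ 0 :=
    Complex.ofReal_ne_zero.mpr fifth_pos.2.ne'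
  field_simp

/-- `p₄ = ℘((2+2i)/5) = −(i/2)(p₂² − e²)/p₂`. [folklore] -/
theorem weierstrassP_two_add_two_I_fifth :
    ℘[ofUpperHalfPlane UpperHalfPlane.I] ((2 + 2 * I) / 5) =
      -(I / 2) * ((((ofUpperHalfPlane UpperHalfPlane.I).weierstrassPRe (2 / 5) : ℝ) : ℂ) ^ 2 -
          ((Real.Gamma (1 / 4) ^ 2 / (2 * Real.sqrt (2 * π)) : ℝ) : ℂ) ^ 4) /
        (((ofUpperHalfPlane UpperHalfPlane.I).weierstrassPRe (2 / 5) : ℝ) : ℂ) := by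
  have h := weierstrassP_one_add_I_mul two_fifths_notMem weierstrassP_fifth_ne_zero.2
  rw [show (1 + I) * (2 / 5 : ℂ) = (2 + 2 * I) / 5 by ring, weierstrassP_two_fifths] at h
  rw [h]
  have hp : (((ofUpperHalfPlane UpperHalfPlane.I).weierstrassPRe (2 / 5) : ℝ) : ℂ) ≠ 0 :=
    Complex.ofReal_ne_zero.mpr fifth_pos.1.ne'
  field_simp

/-- `p₃² = −(p₁² − e²)²/(4p₁²)`, `p₄² = −(p₂² − e²)²/(4p₂²)`. [folklore] -/
theorem weierstrassP_diag_fifth_sq :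
    ℘[ofUpperHalfPlane UpperHalfPlane.I] ((1 + I) / 5) ^ 2 =
        -((((ofUpperHalfPlane UpperHalfPlane.I).weierstrassPRe (1 / 5) : ℝ) : ℂ) ^ 2 -
            ((Real.Gamma (1 / 4) ^ 2 / (2 * Real.sqrt (2 * π)) : ℝ) : ℂ) ^ 4) ^ 2 /
          (4 * (((ofUpperHalfPlane UpperHalfPlane.I).weierstrassPRe (1 / 5) : ℝ) : ℂ) ^ 2) ∧
      ℘[ofUpperHalfPlane UpperHalfPlane.I] ((2 + 2 * I) / 5) ^ 2 =
        -((((ofUpperHalfPlane UpperHalfPlane.I).weierstrassPRe (2 / 5) : ℝ) : ℂ) ^ 2 -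
            ((Real.Gamma (1 / 4) ^ 2 / (2 * Real.sqrt (2 * π)) : ℝ) : ℂ) ^ 4) ^ 2 /
          (4 * (((ofUpperHalfPlane UpperHalfPlane.I).weierstrassPRe (2 / 5) : ℝ) : ℂ) ^ 2) := by
  set a : ℂ := (((ofUpperHalfPlane UpperHalfPlane.I).weierstrassPRe (1 / 5) : ℝ) : ℂ) with ha
  set b : ℂ := (((ofUpperHalfPlane UpperHalfPlane.I).weierstrassPRe (2 / 5) : ℝ) : ℂ) with hb
  set w : ℂ := ((Real.Gamma (1 / 4) ^ 2 / (2 * Real.sqrt (2 * π)) : ℝ) : ℂ) with hw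
  have hp1 : a ≠ 0 := Complex.ofReal_ne_zero.mpr fifth_pos.2.ne'
  have hp2 : b ≠ 0 := Complex.ofReal_ne_zero.mpr fifth_pos.1.ne'
  rw [weierstrassP_one_add_I_fifth, weierstrassP_two_add_two_I_fifth, ← ha, ← hb, ← hw]
  constructor
  · field_simp
    linear_combination 4 * (a ^ 2 - w ^ 4) ^ 2 * I_sq
  · field_simp
    linear_combination 4 * (b ^ 2 - w ^ 4) ^ 2 * I_sq

/-- **Symmetric functions of the diagonal fifth-division values**:
`p₃² + p₄² = (6 − 4√5)e²` and `p₃²p₄² = (9 − 4√5)e⁴` (`p₃ = ℘((1+i)/5)`, `p₄ = ℘((2+2i)/5)`,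
`e² = ϖ₀⁴`; the `ℚ(√5)`-conjugate factor `t² − (6 − 4√5)t + (9 − 4√5)` of the `5`-division
polynomial). From `p₃² = −(p₁² − e²)²/(4p₁²)`, `p₄² = −(p₂² − e²)²/(4p₂²)` and
`fifth_division_vieta` (`(p₁² − e²)(p₂² − e²) = 4e⁴`). [folklore] -/
theorem fifth_diag_sum_sq_and_prod_sq :
    ℘[ofUpperHalfPlane UpperHalfPlane.I] ((1 + I) / 5) ^ 2 +
          ℘[ofUpperHalfPlane UpperHalfPlane.I] ((2 + 2 * I) / 5) ^ 2 =
        (6 - 4 * (Real.sqrt 5 : ℂ)) * ((Real.Gamma (1 / 4) ^ 2 / (2 * Real.sqrt (2 * π)) : ℝ) : ℂ) ^ 4 ∧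
      ℘[ofUpperHalfPlane UpperHalfPlane.I] ((1 + I) / 5) ^ 2 *
          ℘[ofUpperHalfPlane UpperHalfPlane.I] ((2 + 2 * I) / 5) ^ 2 =
        (9 - 4 * (Real.sqrt 5 : ℂ)) * ((Real.Gamma (1 / 4) ^ 2 / (2 * Real.sqrt (2 * π)) : ℝ) : ℂ) ^ 8 := by
  obtain ⟨hS, hP⟩ := fifth_division_vieta
  obtain ⟨hp2, hp1⟩ := fifth_pos
  obtain ⟨h3, h4⟩ := weierstrassP_diag_fifth_sq
  rw [h3, h4]
  set a : ℂ := (((ofUpperHalfPlane UpperHalfPlane.I).weierstrassPRe (1 / 5) : ℝ) : ℂ) with ha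
  set b : ℂ := (((ofUpperHalfPlane UpperHalfPlane.I).weierstrassPRe (2 / 5) : ℝ) : ℂ) with hb
  set w : ℂ := ((Real.Gamma (1 / 4) ^ 2 / (2 * Real.sqrt (2 * π)) : ℝ) : ℂ) with hw
  set f : ℂ := ((Real.sqrt 5 : ℝ) : ℂ) with hf
  have ha0 : a ≠ 0 := by rw [ha]; exact Complex.ofReal_ne_zero.mpr hp1.ne'
  have hb0 : b ≠ 0 := by rw [hb]; exact Complex.ofReal_ne_zero.mpr hp2.ne'
  have hf5 : f ^ 2 = 5 := by
    rw [hf, ← Complex.ofReal_pow, Real.sq_sqrt (by norm_num)]; push_cast; ring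
  have hσ : a ^ 2 + b ^ 2 = (6 + 4 * f) * w ^ 4 := by
    have h' : a ^ 2 + b ^ 2 = (6 + 4 * f) * (w ^ 2) ^ 2 := by
      rw [ha, hb, hf, hw]; exact_mod_cast hS
    rw [h']; ring
  have hπ : a ^ 2 * b ^ 2 = (9 + 4 * f) * w ^ 8 := by
    have h' : a ^ 2 * b ^ 2 = (9 + 4 * f) * (w ^ 2) ^ 4 := by
      rw [ha, hb, hf, hw]; exact_mod_cast hP
    rw [h']; ring
  have hu : (a ^ 2 - w ^ 4) * (b ^ 2 - w ^ 4) = 4 * w ^ 8 := by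
    linear_combination hπ - w ^ 4 * hσ
  have h4a : (4 : ℂ) * a ^ 2 ≠ 0 := mul_ne_zero (by norm_num) (pow_ne_zero 2 ha0)
  have h4b : (4 : ℂ) * b ^ 2 ≠ 0 := mul_ne_zero (by norm_num) (pow_ne_zero 2 hb0)
  constructor
  · rw [div_add_div _ _ h4a h4b, div_eq_iff (mul_ne_zero h4a h4b)]
    linear_combination (-4 * a ^ 2 * b ^ 2 - 4 * w ^ 8) * hσ + ((-104 + 48 * f) * w ^ 4) * hπ +
      192 * w ^ 12 * hf5
  · rw [div_mul_div_comm, div_eq_iff (mul_ne_zero h4a h4b)]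
    linear_combination ((a ^ 2 - w ^ 4) * (b ^ 2 - w ^ 4) + 4 * w ^ 8) * hu -
      (144 - 64 * f) * w ^ 8 * hπ + 256 * w ^ 16 * hf5

/-- **Complex form of the real fifth-division symmetric functions**
(`GaussianLatticeFifthDivision.fifth_division_vieta`):
`℘(1/5)² + ℘(2/5)² = (6 + 4√5)ϖ₀⁴`, `℘(1/5)²℘(2/5)² = (9 + 4√5)ϖ₀⁸`. [folklore] -/
theorem weierstrassP_fifth_sum_sq_and_prod_sq :
    ℘[ofUpperHalfPlane UpperHalfPlane.I] (1 / 5) ^ 2 + ℘[ofUpperHalfPlane UpperHalfPlane.I] (2 / 5) ^ 2 =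
        (6 + 4 * (Real.sqrt 5 : ℂ)) * ((Real.Gamma (1 / 4) ^ 2 / (2 * Real.sqrt (2 * π)) : ℝ) : ℂ) ^ 4 ∧
      ℘[ofUpperHalfPlane UpperHalfPlane.I] (1 / 5) ^ 2 * ℘[ofUpperHalfPlane UpperHalfPlane.I] (2 / 5) ^ 2 =
        (9 + 4 * (Real.sqrt 5 : ℂ)) * ((Real.Gamma (1 / 4) ^ 2 / (2 * Real.sqrt (2 * π)) : ℝ) : ℂ) ^ 8 := by
  obtain ⟨hS, hP⟩ := fifth_division_vieta
  rw [weierstrassP_one_fifth, weierstrassP_two_fifths]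
  set a : ℂ := (((ofUpperHalfPlane UpperHalfPlane.I).weierstrassPRe (1 / 5) : ℝ) : ℂ) with ha
  set b : ℂ := (((ofUpperHalfPlane UpperHalfPlane.I).weierstrassPRe (2 / 5) : ℝ) : ℂ) with hb
  set w : ℂ := ((Real.Gamma (1 / 4) ^ 2 / (2 * Real.sqrt (2 * π)) : ℝ) : ℂ) with hw
  constructor
  · have h' : a ^ 2 + b ^ 2 = (6 + 4 * (Real.sqrt 5 : ℂ)) * (w ^ 2) ^ 2 := by
      rw [ha, hb, hw]; exact_mod_cast hS
    rw [h']; ring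
  · have h' : a ^ 2 * b ^ 2 = (9 + 4 * (Real.sqrt 5 : ℂ)) * (w ^ 2) ^ 4 := by
      rw [ha, hb, hw]; exact_mod_cast hP
    rw [h']; ring

/-! ### The half-period shift `℘(z + ω₃) = −e²/℘(z)` and its derivative -/

/-- **Shift by the third half-period** `ω₃ = (1+i)/2` (`℘(ω₃) = 0 = ℘'(ω₃)`): for `z ∉ Λ` with
`℘(z) ≠ 0`, `℘(z + ω₃) = −(g₂/4)/℘(z)` (`= e₃ + (e₃ − e₁)(e₃ − e₂)/(℘(z) − e₃)` with
`e₁, e₂, e₃ = e, −e, 0`; addition theorem at `(z, ω₃)`). [folklore] -/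
theorem weierstrassP_add_omega₃ {z : ℂ} (hz : z ∉ (ofUpperHalfPlane UpperHalfPlane.I).lattice)
    (h0 : ℘[ofUpperHalfPlane UpperHalfPlane.I] z ≠ 0) :
    ℘[ofUpperHalfPlane UpperHalfPlane.I] (z + (1 + I) / 2) =
      -((ofUpperHalfPlane UpperHalfPlane.I).g₂ / 4) / ℘[ofUpperHalfPlane UpperHalfPlane.I] z := by
  have hne : ℘[ofUpperHalfPlane UpperHalfPlane.I] z ≠
      ℘[ofUpperHalfPlane UpperHalfPlane.I] ((1 + I) / 2) := by
    rwa [weierstrassP_one_add_I_half]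
  have h := weierstrassP_add_holds (L := ofUpperHalfPlane UpperHalfPlane.I) _ _ hz
    one_add_I_half_notMem hne
  rw [weierstrassP_one_add_I_half, derivWeierstrassP_one_add_I_half, sub_zero, sub_zero, sub_zero]
    at h
  have hsq := (ofUpperHalfPlane UpperHalfPlane.I).derivWeierstrassP_sq z hz
  rw [g₃_ofUpperHalfPlane_I, sub_zero] at hsq
  rw [h]
  field_simp
  linear_combination hsq

/-- **Derivative of the half-period shift**: `℘'(z + ω₃) = (g₂/4)℘'(z)/℘(z)²` for `z ∉ Λ`,
`℘(z) ≠ 0` (differentiate `℘(w + ω₃) = −(g₂/4)/℘(w)`, valid for `w` near `z`). [folklore] -/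
theorem derivWeierstrassP_add_omega₃ {z : ℂ} (hz : z ∉ (ofUpperHalfPlane UpperHalfPlane.I).lattice)
    (h0 : ℘[ofUpperHalfPlane UpperHalfPlane.I] z ≠ 0) :
    ℘'[ofUpperHalfPlane UpperHalfPlane.I] (z + (1 + I) / 2) =
      (ofUpperHalfPlane UpperHalfPlane.I).g₂ / 4 * ℘'[ofUpperHalfPlane UpperHalfPlane.I] z /
        ℘[ofUpperHalfPlane UpperHalfPlane.I] z ^ 2 := by
  -- the identity holds on a neighbourhood of `z`
  have hopen : IsOpen ((ofUpperHalfPlane UpperHalfPlane.I).lattice : Set ℂ)ᶜ :=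
    (ofUpperHalfPlane UpperHalfPlane.I).isClosed_lattice.isOpen_compl
  have hcont : ContinuousAt ℘[ofUpperHalfPlane UpperHalfPlane.I] z :=
    ((ofUpperHalfPlane UpperHalfPlane.I).differentiableOn_weierstrassP.differentiableAt
      (hopen.mem_nhds hz)).continuousAt
  have hev : ∀ᶠ w in 𝓝 z, w ∉ (ofUpperHalfPlane UpperHalfPlane.I).lattice ∧
      ℘[ofUpperHalfPlane UpperHalfPlane.I] w ≠ 0 :=
    (hopen.eventually_mem hz).and (hcont.eventually_ne h0)
  have heq : (fun w ↦ ℘[ofUpperHalfPlane UpperHalfPlane.I] (w + (1 + I) / 2)) =ᶠ[𝓝 z]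
      fun w ↦ -((ofUpperHalfPlane UpperHalfPlane.I).g₂ / 4) *
        (℘[ofUpperHalfPlane UpperHalfPlane.I] w)⁻¹ := by
    filter_upwards [hev] with w hw
    rw [weierstrassP_add_omega₃ hw.1 hw.2, div_eq_mul_inv]
  -- `z + ω₃ ∉ Λ` (else `℘(z) = ℘(-ω₃) = 0`)
  have hz3 : z + (1 + I) / 2 ∉ (ofUpperHalfPlane UpperHalfPlane.I).lattice := by
    intro hmem
    apply h0
    have h1 : ℘[ofUpperHalfPlane UpperHalfPlane.I] z =
        ℘[ofUpperHalfPlane UpperHalfPlane.I] (-((1 + I) / 2) + (z + (1 + I) / 2)) := by ring_nf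
    rw [h1, ← Subtype.coe_mk (z + (1 + I) / 2) hmem,
      (ofUpperHalfPlane UpperHalfPlane.I).weierstrassP_add_coe,
      (ofUpperHalfPlane UpperHalfPlane.I).weierstrassP_neg, weierstrassP_one_add_I_half]
  have hL : HasDerivAt (fun w ↦ ℘[ofUpperHalfPlane UpperHalfPlane.I] (w + (1 + I) / 2))
      (℘'[ofUpperHalfPlane UpperHalfPlane.I] (z + (1 + I) / 2)) z :=
    ((ofUpperHalfPlane UpperHalfPlane.I).hasDerivAt_weierstrassP hz3).comp_add_const z ((1 + I) / 2)
  have hR : HasDerivAt (fun w ↦ -((ofUpperHalfPlane UpperHalfPlane.I).g₂ / 4) *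
      (℘[ofUpperHalfPlane UpperHalfPlane.I] w)⁻¹)
      (-((ofUpperHalfPlane UpperHalfPlane.I).g₂ / 4) *
        (-(℘'[ofUpperHalfPlane UpperHalfPlane.I] z) / ℘[ofUpperHalfPlane UpperHalfPlane.I] z ^ 2)) z :=
    (((ofUpperHalfPlane UpperHalfPlane.I).hasDerivAt_weierstrassP hz).inv h0).const_mul _
  have := hL.unique (hR.congr_of_eventuallyEq heq)
  rw [this]
  field_simp

/-! ### A quarter point and a fifth point have `℘(u) ≠ ±℘(v)` -/

/-- **A quarter point and a fifth point have distinct `℘`-values, even up to sign**: if `4u ∈ Λ`,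
`5v ∈ Λ`, `u, v ∉ Λ`, then `℘(u) ≠ ℘(v)` and `℘(u) ≠ −℘(v)` (`℘(u) = ℘(w)` forces `u ≡ ±w`, and
then `u = 5u − 4u ∈ Λ`; for the sign, `−℘(v) = ℘(iv)`). [folklore] -/
theorem weierstrassP_quarter_ne_fifth {u v : ℂ} (hu : u ∉ (ofUpperHalfPlane UpperHalfPlane.I).lattice)
    (hv : v ∉ (ofUpperHalfPlane UpperHalfPlane.I).lattice)
    (h4 : 4 * u ∈ (ofUpperHalfPlane UpperHalfPlane.I).lattice)
    (h5 : 5 * v ∈ (ofUpperHalfPlane UpperHalfPlane.I).lattice) :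
    ℘[ofUpperHalfPlane UpperHalfPlane.I] u ≠ ℘[ofUpperHalfPlane UpperHalfPlane.I] v ∧
      ℘[ofUpperHalfPlane UpperHalfPlane.I] u ≠ -℘[ofUpperHalfPlane UpperHalfPlane.I] v := by
  have hmul5 : ∀ x : ℂ, x ∈ (ofUpperHalfPlane UpperHalfPlane.I).lattice →
      5 * x ∈ (ofUpperHalfPlane UpperHalfPlane.I).lattice := by
    intro x hx
    have := (ofUpperHalfPlane UpperHalfPlane.I).lattice.smul_mem (5 : ℤ) hx
    simpa using this
  have key : ∀ w : ℂ, w ∉ (ofUpperHalfPlane UpperHalfPlane.I).lattice →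
      5 * w ∈ (ofUpperHalfPlane UpperHalfPlane.I).lattice →
      ℘[ofUpperHalfPlane UpperHalfPlane.I] u ≠ ℘[ofUpperHalfPlane UpperHalfPlane.I] w := by
    intro w hw h5w heq
    rcases ((ofUpperHalfPlane UpperHalfPlane.I).weierstrassP_eq_weierstrassP_iff hu hw).mp heq
      with h | h
    · -- `u + w ∈ Λ`: `u = 5(u+w) - 5w - 4u`
      apply hu
      have : u = 5 * (u + w) - 5 * w - 4 * u := by ring
      rw [this]
      exact sub_mem (sub_mem (hmul5 _ h) h5w) h4
    · apply hu
      have : u = 5 * (u - w) + 5 * w - 4 * u := by ring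
      rw [this]
      exact sub_mem (add_mem (hmul5 _ h) h5w) h4
  have hIv : I * v ∉ (ofUpperHalfPlane UpperHalfPlane.I).lattice := fun h ↦
    hv ((I_mul_mem_lattice_ofUpperHalfPlane_I_iff v).mp h)
  have h5I : 5 * (I * v) ∈ (ofUpperHalfPlane UpperHalfPlane.I).lattice := by
    rw [show 5 * (I * v) = I * (5 * v) by ring]
    exact (I_mul_mem_lattice_ofUpperHalfPlane_I_iff _).mpr h5
  refine ⟨key v hv h5, ?_⟩
  rw [← weierstrassP_I_mul]
  exact key (I * v) hIv h5I

end GaussianLattice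

end Literature.NumberTheory.EllipticCurves

end
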